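import Summits.CriticalPhenomena.PercolationContinuityZ3.Theses.PercShatteringRace
import Literature.Probability.Percolation.PercolationEvents

/-!
# Crux `PercShatteringRace.NearLinearTwoClusterDecay` (stmt-CriticalPhenomena-5785), line `shell-product-kiss-positivity` — stub `stub_doorCauchySchwarz`

Helper file for the lead's skeleton of line `shell-product-kiss-positivity`
(`Cruxes/NearLinearTwoClusterDecay/Lines/shell_product_kiss_positivity.lean`, skeleton rev L1-c1,
prover-line-stmt-CriticalPhenomena-5785-c1-0). Proves exactly the registered stub signature
`stub_doorCauchySchwarz`; lands with `--supports stmt-CriticalPhenomena-5785`.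

## The statement (generic Cauchy–Schwarz step of the door bound, Bernoulli bond percolation on `ℤ³`)

For an event `A` determined by a finite pair set `E` and a non-negative function `F ≤ B` on bond
configurations congruent under agreement on `E`,
`(∫_A F dP_p)² ≤ P_p(A ∩ {F ≠ 0}) · ∫_A F² dP_p`.

## The argument (elementary quadratic route, no `L²` machinery)

* `NearLinearTwoClusterDecayDoorCauchySchwarz.measurable_of_congr`: a function congruent under
  agreement on a finite coordinate set is measurable — every preimage is determined by `E`
  (`determinedBy_iff`), hence measurable (`DeterminedBy.measurableSet_of_finset`). With
  `0 ≤ F ≤ B` this makes `F` and `F²` integrable for the finite measure `P_p|_A`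
  (`Integrable.of_mem_Icc`).
* `…sq_integral_le_measureReal_mul`: for a finite measure `μ`, a measurable set `S` and an
  integrable `F` (with `F²` integrable) vanishing off `S`, `(∫ F dμ)² ≤ μ(S) · ∫ F² dμ`: the
  quadratic `x ↦ ∫ (x·1_S - F)² dμ = μ(S) x² - 2 (∫ F dμ) x + ∫ F² dμ` (`…integral_quadratic_eq`,
  pointwise `(x·1_S - F)² = x² 1_S - 2 x F + F²` because `F = 0` off `S`) is non-negative, so its
  discriminant `4 (∫ F)² - 4 μ(S) ∫ F²` is `≤ 0` (Mathlib `discrim_le_zero`).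
* The stub: apply this to `μ = P_p|_A`, `S = {F ≠ 0}` and unfold
  `(P_p|_A)(S) = P_p(A ∩ S)` (`measureReal_restrict_apply`).

Tree API used: `determinedBy_iff`, `DeterminedBy.measurableSet_of_finset`. No new definitions,
no named facts.
-/

noncomputable section

open MeasureTheory
open Literature.Probability.LatticeModels Literature.Probability.Percolation

namespace Summit.CriticalPhenomena.PercolationContinuityZ3.Theorems

namespace NearLinearTwoClusterDecayDoorCauchySchwarz

/-- **Local functions are measurable.** A function of configurations `ω : Set ι` which is
congruent under agreement on a finite coordinate set `E` (`ω ∩ E = ω' ∩ E ⇒ F ω = F ω'`) is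
measurable for the product σ-algebra: each preimage `F ⁻¹' s` is an event determined by `E`,
hence measurable (`DeterminedBy.measurableSet_of_finset`). [folklore] -/
theorem measurable_of_congr {ι β : Type*} [MeasurableSpace β] {E : Finset ι} {F : Set ι → β}
    (hF : ∀ ω ω' : Set ι, ω ∩ ↑E = ω' ∩ ↑E → F ω = F ω') : Measurable F := by
  intro s _
  refine DeterminedBy.measurableSet_of_finset (F := E) ?_
  rw [determinedBy_iff]
  intro ω ω' h
  simp only [Set.mem_preimage, hF ω ω' h]

/-- **Expansion of the quadratic.** For a finite measure `μ`, a measurable set `S` and an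
integrable `F` with `F²` integrable,
`∫ (x² · 1_S - 2 x · F + F²) dμ = μ(S) · x² + (-2 ∫ F dμ) · x + ∫ F² dμ` (linearity of the
integral, `∫ 1_S dμ = μ(S)`). [folklore] -/
theorem integral_quadratic_eq {α : Type*} [MeasurableSpace α] (μ : Measure α) [IsFiniteMeasure μ]
    {F : α → ℝ} {S : Set α} (hSm : MeasurableSet S) (hFi : Integrable F μ)
    (hF2i : Integrable (fun ω => F ω ^ 2) μ) (x : ℝ) :
    ∫ ω, (x * x * S.indicator (fun _ => (1 : ℝ)) ω - 2 * x * F ω + F ω ^ 2) ∂μ =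
      μ.real S * (x * x) + (-2 * ∫ ω, F ω ∂μ) * x + ∫ ω, F ω ^ 2 ∂μ := by
  have h1 : Integrable (fun ω => x * x * S.indicator (fun _ => (1 : ℝ)) ω) μ :=
    ((integrable_const (1 : ℝ)).indicator hSm).const_mul (x * x)
  have h2 : Integrable (fun ω => 2 * x * F ω) μ := hFi.const_mul (2 * x)
  rw [integral_add (h1.sub' h2) hF2i, integral_sub h1 h2, integral_const_mul, integral_const_mul,
    integral_indicator_const _ hSm, smul_eq_mul, mul_one]
  ring

/-- **Cauchy–Schwarz against the support (finite measure, real-valued).** If `F` is integrable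
with `F²` integrable and vanishes off the measurable set `S`, then
`(∫ F dμ)² ≤ μ(S) · ∫ F² dμ`. Proof: for every real `x`,
`0 ≤ ∫ (x·1_S - F)² dμ = μ(S) x² - 2 (∫ F) x + ∫ F²` (pointwise `(x·1_S - F)² = x² 1_S - 2xF + F²`
as `F = 0` off `S`; `integral_quadratic_eq`), so the discriminant `4 (∫ F)² - 4 μ(S) ∫ F²` of this
quadratic is non-positive (`discrim_le_zero`). [folklore] -/
theorem sq_integral_le_measureReal_mul {α : Type*} [MeasurableSpace α] (μ : Measure α)
    [IsFiniteMeasure μ] {F : α → ℝ} {S : Set α} (hSm : MeasurableSet S)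
    (hFS : ∀ ω, ω ∉ S → F ω = 0) (hFi : Integrable F μ)
    (hF2i : Integrable (fun ω => F ω ^ 2) μ) :
    (∫ ω, F ω ∂μ) ^ 2 ≤ μ.real S * ∫ ω, F ω ^ 2 ∂μ := by
  have hpt : ∀ (x : ℝ) (ω : α), (x * S.indicator (fun _ => (1 : ℝ)) ω - F ω) ^ 2 =
      x * x * S.indicator (fun _ => (1 : ℝ)) ω - 2 * x * F ω + F ω ^ 2 := by
    intro x ω
    by_cases hω : ω ∈ S
    · rw [Set.indicator_of_mem hω]; ring
    · rw [Set.indicator_of_notMem hω, hFS ω hω]; ring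
  have hquad : ∀ x : ℝ,
      0 ≤ μ.real S * (x * x) + (-2 * ∫ ω, F ω ∂μ) * x + ∫ ω, F ω ^ 2 ∂μ := by
    intro x
    calc (0 : ℝ) ≤ ∫ ω, (x * S.indicator (fun _ => (1 : ℝ)) ω - F ω) ^ 2 ∂μ :=
          integral_nonneg fun ω => sq_nonneg _
      _ = ∫ ω, (x * x * S.indicator (fun _ => (1 : ℝ)) ω - 2 * x * F ω + F ω ^ 2) ∂μ :=
          integral_congr_ae (ae_of_all _ (hpt x))
      _ = μ.real S * (x * x) + (-2 * ∫ ω, F ω ∂μ) * x + ∫ ω, F ω ^ 2 ∂μ :=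
          integral_quadratic_eq μ hSm hFi hF2i x
  have hd : discrim (μ.real S) (-2 * ∫ ω, F ω ∂μ) (∫ ω, F ω ^ 2 ∂μ) ≤ 0 := discrim_le_zero hquad
  rw [discrim] at hd
  nlinarith [hd]

end NearLinearTwoClusterDecayDoorCauchySchwarz

open NearLinearTwoClusterDecayDoorCauchySchwarz in
/-- **Registered stub `stub_doorCauchySchwarz`** of line `shell-product-kiss-positivity` (crux
`NearLinearTwoClusterDecay`, stmt-CriticalPhenomena-5785): the **Cauchy–Schwarz step of the door
bound** for bond percolation on `ℤ³` at any density `p`. For an event `A` determined by a finite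
pair set `E` and a function `0 ≤ F ≤ B` congruent under agreement on `E`,
`(∫_A F dP_p)² ≤ P_p(A ∩ {F ≠ 0}) · ∫_A F² dP_p`.
Proof: `F` is measurable (`measurable_of_congr`), so `F`, `F²` are integrable on the finite
measure `P_p|_A` (`Integrable.of_mem_Icc` with the bounds `0 ≤ F ≤ B`, `0 ≤ F² ≤ B²`) and
`{F ≠ 0}` is measurable (`measurableSet_support`); conclude by `sq_integral_le_measureReal_mul`
for `μ = P_p|_A`, `S = {F ≠ 0}`, and `(P_p|_A)(S) = P_p(A ∩ S)` (`measureReal_restrict_apply`).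
The hypothesis that `A` is determined by `E` (part of the registered signature) is not used:
`Measure.restrict` and `measureReal_restrict_apply` only need `{F ≠ 0}` to be measurable.
[folklore] -/
theorem stub_doorCauchySchwarz :
    ∀ (p : unitInterval) (E : Finset (Sym2 (Site 3))) (A : Set (BondConfig (Site 3)))
      (F : BondConfig (Site 3) → ℝ) (B : ℝ),
      DeterminedBy A (↑E : Set (Sym2 (Site 3))) →
      (∀ ω ω' : BondConfig (Site 3), ω ∩ ↑E = ω' ∩ ↑E → F ω = F ω') →
      (∀ ω, 0 ≤ F ω) → (∀ ω, F ω ≤ B) →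
      (∫ ω in A, F ω ∂(bondPercolation (zdGraph 3) p)) ^ 2 ≤
        (bondPercolation (zdGraph 3) p).real (A ∩ {ω | F ω ≠ 0}) *
          ∫ ω in A, F ω ^ 2 ∂(bondPercolation (zdGraph 3) p) := by
  intro p E A F B _hA hF h0 hB
  set P : Measure (BondConfig (Site 3)) := bondPercolation (zdGraph 3) p
  have _hPinst : IsProbabilityMeasure P := instIsProbabilityMeasureBondPercolation _ _
  have hFm : Measurable F := measurable_of_congr hF
  have hSm : MeasurableSet {ω : BondConfig (Site 3) | F ω ≠ 0} := measurableSet_support hFm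
  have hFS : ∀ ω, ω ∉ {ω : BondConfig (Site 3) | F ω ≠ 0} → F ω = 0 := fun ω hω => by
    simpa using hω
  have hFi : Integrable F (P.restrict A) :=
    Integrable.of_mem_Icc 0 B hFm.aemeasurable (ae_of_all _ fun ω => ⟨h0 ω, hB ω⟩)
  have hF2i : Integrable (fun ω => F ω ^ 2) (P.restrict A) :=
    Integrable.of_mem_Icc 0 (B ^ 2) (hFm.pow_const 2).aemeasurable
      (ae_of_all _ fun ω => ⟨sq_nonneg _, pow_le_pow_left₀ (h0 ω) (hB ω) 2⟩)
  have h := sq_integral_le_measureReal_mul (P.restrict A) hSm hFS hFi hF2i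
  rwa [measureReal_restrict_apply hSm, Set.inter_comm] at h

end Summit.CriticalPhenomena.PercolationContinuityZ3.Theorems

end
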